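/-
# The two-Sylow packing law in `GL₂(𝔽_p)` (hypothesis-free on shapes)

Cell B2b-5 (`b2b-lgcu-borel`, generation 14), supporting the crux `SubgroupIdentityDesigns`
(`stmt-MatrixMultiplication-14079`) of the route `LevelGradedCohnUmans`.

HONEST FRAMING.  VALUE = THEOREM (a structural law for the decidable `(m,k) = (2,1)` cell of the
crux) — NOT summit progress.  Nothing here bears on `ω`.
-/
import Summits.MatrixMultiplication.MatrixMultiplication.Theorems.SubgroupIdentityDesigns.Negative.Transvections
import Summits.MatrixMultiplication.MatrixMultiplication.Theorems.SubgroupIdentityDesigns.Negative.DecoratedSylowLaw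
import Summits.MatrixMultiplication.MatrixMultiplication.Theorems.SubgroupIdentityDesigns.Negative.StandardLines

/-!
## Statement

**Two-Sylow packing law.**  If `H, H' ≤ GL₂(𝔽_p)` are subgroups with `H ∩ H' = 1` whose orders are
both divisible by `p`, then `|H| · |H'| ≤ p² (p - 1)²` (`= |B| · |U|`, attained by a Borel subgroup
and the opposite root group).  No shape hypothesis: the Borel normal form is derived.

Proof.  By Cauchy (`exists_transvection`) `H ∋ g`, `H' ∋ g'` transvections; their fixed lines are
distinct (a common fixed line puts a common root group inside `H ∩ H'`,
`not_disjoint_of_common_fixed`).  In the frame `c = (v | v')` of the two fixed vectors,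
`U⁺ ≤ c⁻¹ H c` and `U⁻ ≤ c⁻¹ H' c`; the root lemma (`lower_mem_of_upper_mem`) and disjointness force
`c⁻¹ H c ≤ B⁺`, `c⁻¹ H' c ≤ B⁻`; the two diagonal images `D, D' ≤ T` meet trivially (a common
diagonal value is a diagonal matrix of `c⁻¹ H c ∩ c⁻¹ H' c`), so `|D| |D'| ≤ |T| = (p - 1)²`, and
`|H| ≤ p |D|`, `|H'| ≤ p |D'|`.

Corollaries for subgroup TPP triples (whose members are pairwise disjoint): the product of the
orders of any two members divisible by `p` is at most `p² (p - 1)²`, and a triple with at least two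
such members has volume `≤ p² (p - 1)² · (order of the third)`.

Report: `run/shared/lean/b2b/levelgraded-cu/ORACLE-g14.md` §G14-4.  Sorry-free; no new definitions.
-/

set_option linter.dupNamespace false

noncomputable section

open scoped BigOperators Classical
open Summit.MatrixMultiplication.MatrixMultiplication.Theorems.LieRankDesigns.Negative (GLm Mat)

namespace Summit.MatrixMultiplication.MatrixMultiplication.Theorems.SubgroupIdentityDesigns.Negative

section TwoSylowLaw

open Literature.Barriers.MatrixMultiplication (SubgroupTPP)

variable {p : ℕ} [hp : Fact p.Prime]

/-- Disjoint subgroups `U⁺ ≤ K ≤ B⁺` and `U⁻ ≤ K' ≤ B⁻` have diagonal images meeting trivially. -/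
theorem diag_meet_trivial_of_disjoint {K K' : Subgroup (GLm p 2)}
    (hB : ∀ h ∈ K, (h : Mat p 2) 1 0 = 0)
    (hU : ∀ u : GLm p 2, (u : Mat p 2) 1 0 = 0 → (u : Mat p 2) 0 0 = 1 → (u : Mat p 2) 1 1 = 1 →
      u ∈ K)
    (hB' : ∀ h ∈ K', (h : Mat p 2) 0 1 = 0)
    (hU' : ∀ u : GLm p 2, (u : Mat p 2) 0 1 = 0 → (u : Mat p 2) 0 0 = 1 → (u : Mat p 2) 1 1 = 1 →
      u ∈ K')
    (hd : Disjoint K K')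
    {φ : K →* (ZMod p)ˣ × (ZMod p)ˣ} (hφ : ∀ h : K,
      ((φ h).1 : ZMod p) = ((h : GLm p 2) : Mat p 2) 0 0 ∧
        ((φ h).2 : ZMod p) = ((h : GLm p 2) : Mat p 2) 1 1)
    {φ' : K' →* (ZMod p)ˣ × (ZMod p)ˣ} (hφ' : ∀ h : K',
      ((φ' h).1 : ZMod p) = ((h : GLm p 2) : Mat p 2) 0 0 ∧
        ((φ' h).2 : ZMod p) = ((h : GLm p 2) : Mat p 2) 1 1)
    {d : (ZMod p)ˣ × (ZMod p)ˣ} (h1 : d ∈ φ.range) (h2 : d ∈ φ'.range) : d = 1 := by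
  obtain ⟨x, hx⟩ := h1
  obtain ⟨x', hx'⟩ := h2
  have a1 : ((x : GLm p 2) : Mat p 2) 0 0 = (d.1 : ZMod p) := by rw [← (hφ x).1, hx]
  have b1 : ((x : GLm p 2) : Mat p 2) 1 1 = (d.2 : ZMod p) := by rw [← (hφ x).2, hx]
  have a2 : ((x' : GLm p 2) : Mat p 2) 0 0 = (d.1 : ZMod p) := by rw [← (hφ' x').1, hx']
  have b2 : ((x' : GLm p 2) : Mat p 2) 1 1 = (d.2 : ZMod p) := by rw [← (hφ' x').2, hx']
  obtain ⟨g, g00, g01, g10, g11⟩ := exists_gl2 (d.1 : ZMod p) 0 0 (d.2 : ZMod p)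
    (by rw [mul_zero, sub_zero]; exact mul_ne_zero d.1.ne_zero d.2.ne_zero)
  have g1 : g ∈ K := mem_of_upper_diag hB hU g10 x.2 (by rw [a1, g00]) (by rw [b1, g11])
  have g2 : g ∈ K' := mem_of_lower_diag hB' hU' g01 x'.2 (by rw [a2, g00]) (by rw [b2, g11])
  have e : g = 1 := Subgroup.disjoint_def.1 hd g1 g2
  rw [e] at g00 g11
  refine Prod.ext (Units.val_eq_one.mp ?_) (Units.val_eq_one.mp ?_)
  · rw [← g00]; exact gl2_one_apply.1
  · rw [← g11]; exact gl2_one_apply.2.2.2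

omit hp in
/-- Two subgroups of the torus `T = 𝔽_pˣ × 𝔽_pˣ` meeting trivially have `|D| · |D'| ≤ (p - 1)²`. -/
theorem card_mul_card_le_of_meet_trivial [Fact p.Prime] {D D' : Subgroup ((ZMod p)ˣ × (ZMod p)ˣ)}
    (h : ∀ d, d ∈ D → d ∈ D' → d = 1) : Nat.card D * Nat.card D' ≤ (p - 1) ^ 2 := by
  let Ψ : D × D' → (ZMod p)ˣ × (ZMod p)ˣ := fun t => (t.1 : (ZMod p)ˣ × (ZMod p)ˣ) * t.2
  have hΨ : Function.Injective Ψ := by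
    rintro ⟨a, b⟩ ⟨a', b'⟩ e
    change (a : (ZMod p)ˣ × (ZMod p)ˣ) * b = (a' : (ZMod p)ˣ × (ZMod p)ˣ) * b' at e
    have hq : (a' : (ZMod p)ˣ × (ZMod p)ˣ)⁻¹ * a =
        (b' : (ZMod p)ˣ × (ZMod p)ˣ) * (b : (ZMod p)ˣ × (ZMod p)ˣ)⁻¹ := by
      rw [inv_mul_eq_iff_eq_mul, ← mul_assoc, eq_mul_inv_iff_mul_eq, e]
    have m1 : (a' : (ZMod p)ˣ × (ZMod p)ˣ)⁻¹ * a ∈ D := D.mul_mem (D.inv_mem a'.2) a.2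
    have m2 : (a' : (ZMod p)ˣ × (ZMod p)ˣ)⁻¹ * a ∈ D' := by
      rw [hq]; exact D'.mul_mem b'.2 (D'.inv_mem b.2)
    have u := h _ m1 m2
    have ja : a' = a := Subtype.ext (inv_mul_eq_one.mp u)
    have jb : b' = b := Subtype.ext (mul_inv_eq_one.mp (by rw [← hq, u]))
    rw [ja, jb]
  calc Nat.card D * Nat.card D' = Nat.card (D × D') := (Nat.card_prod _ _).symm
    _ ≤ Nat.card ((ZMod p)ˣ × (ZMod p)ˣ) := Nat.card_le_card_of_injective Ψ hΨ
    _ = (p - 1) ^ 2 := by rw [Nat.card_prod, natCard_units, sq]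

/-- **THE TWO-SYLOW PACKING LAW (hypothesis-free).**  Two disjoint subgroups of `GL₂(𝔽_p)` whose
orders are divisible by `p` satisfy `|H| · |H'| ≤ p² (p - 1)²`. -/
theorem disjoint_product_le {H H' : Subgroup (GLm p 2)} (hd : Disjoint H H')
    (h : p ∣ Nat.card H) (h' : p ∣ Nat.card H') :
    Nat.card H * Nat.card H' ≤ p ^ 2 * (p - 1) ^ 2 := by
  obtain ⟨g, hg, hg1, hdet, v, hv, hfix⟩ := exists_transvection h
  obtain ⟨g', hg', hg'1, hdet', v', hv', hfix'⟩ := exists_transvection h'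
  -- Step 1: distinct fixed lines.
  have hD : v 0 * v' 1 - v' 0 * v 1 ≠ 0 := fun e =>
    not_disjoint_of_common_fixed hg hg' hg1 hg'1 hdet hdet' hv'
      (fixed_of_det_eq_zero hv hfix.1 hfix.2 e) hfix' hd
  -- Step 2: the frame `c = (v | v')` and the flip `w`.
  obtain ⟨c, c00, c01, c10, c11⟩ := exists_gl2 (v 0) (v' 0) (v 1) (v' 1) hD
  obtain ⟨w, w00, w01, w10, w11⟩ := exists_gl2 (0 : ZMod p) 1 1 0 (by simp)
  have hL := upper_le_map_conj (z := c) hg hg1 hdet (by rw [c00, c10]; exact hfix.1)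
    (by rw [c00, c10]; exact hfix.2)
  have hcw0 : ((c * w : GLm p 2) : Mat p 2) 0 0 = v' 0 := by
    rw [gl2_mul_apply, c00, c01, w00, w10]; ring
  have hcw1 : ((c * w : GLm p 2) : Mat p 2) 1 0 = v' 1 := by
    rw [gl2_mul_apply, c10, c11, w00, w10]; ring
  have hL' := upper_le_map_conj (z := c * w) hg' hg'1 hdet' (by rw [hcw0, hcw1]; exact hfix'.1)
    (by rw [hcw0, hcw1]; exact hfix'.2)
  have movw : ∀ {L : Subgroup (GLm p 2)} {x : GLm p 2},
      (w⁻¹ * x * w ∈ L.map (MulAut.conj (c * w)⁻¹).toMonoidHom ↔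
        x ∈ L.map (MulAut.conj c⁻¹).toMonoidHom) := by
    intro L x
    rw [mem_map_conj_inv_iff, mem_map_conj_inv_iff]
    have e : c * w * (w⁻¹ * x * w) * (c * w)⁻¹ = c * x * c⁻¹ := by group
    rw [e]
  -- Step 3: `U⁺ ≤ K = c⁻¹ H c`, `U⁻ ≤ K' = c⁻¹ H' c`, and `K ∩ K' = 1`.
  have hU : ∀ u : GLm p 2, (u : Mat p 2) 1 0 = 0 → (u : Mat p 2) 0 0 = 1 → (u : Mat p 2) 1 1 = 1 →
      u ∈ H.map (MulAut.conj c⁻¹).toMonoidHom := hL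
  have hU' : ∀ u : GLm p 2, (u : Mat p 2) 0 1 = 0 → (u : Mat p 2) 0 0 = 1 → (u : Mat p 2) 1 1 = 1 →
      u ∈ H'.map (MulAut.conj c⁻¹).toMonoidHom := by
    intro u h01 h00 h11
    obtain ⟨e00, -, e10, e11⟩ := conj_w_apply w00 w01 w10 w11 u
    exact movw.1 (hL' _ (by rw [e10, h01]) (by rw [e00, h11]) (by rw [e11, h00]))
  have hdK : Disjoint (H.map (MulAut.conj c⁻¹).toMonoidHom)
      (H'.map (MulAut.conj c⁻¹).toMonoidHom) := by
    rw [Subgroup.disjoint_def]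
    intro x hx hx'
    rw [mem_map_conj_inv_iff] at hx hx'
    have e : c * x * c⁻¹ = 1 := Subgroup.disjoint_def.1 hd hx hx'
    calc x = c⁻¹ * (c * x * c⁻¹) * c := by group
      _ = 1 := by rw [e]; group
  -- Two test unipotents `E₁₂(1)`, `E₂₁(1)`.
  obtain ⟨uU, uU00, uU01, uU10, uU11⟩ := exists_gl2 (1 : ZMod p) 1 0 1 (by simp)
  obtain ⟨uL, uL00, uL01, uL10, uL11⟩ := exists_gl2 (1 : ZMod p) 0 1 1 (by simp)
  have huU1 : uU ≠ 1 := fun e =>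
    one_ne_zero (by rw [← uU01, e]; exact (gl2_one_apply (p := p)).2.1)
  have huL1 : uL ≠ 1 := fun e =>
    one_ne_zero (by rw [← uL10, e]; exact (gl2_one_apply (p := p)).2.2.1)
  have huU := hU uU uU10 uU00 uU11
  have huL := hU' uL uL01 uL00 uL11
  -- Step 4: Borel containments, by the root lemma and disjointness.
  have hB : ∀ k ∈ H.map (MulAut.conj c⁻¹).toMonoidHom, (k : Mat p 2) 1 0 = 0 := by
    intro k hk
    by_contra hne
    exact huL1 (Subgroup.disjoint_def.1 hdK
      (lower_mem_of_upper_mem hU hk hne uL uL01 uL00 uL11) huL)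
  have hB' : ∀ k ∈ H'.map (MulAut.conj c⁻¹).toMonoidHom, (k : Mat p 2) 0 1 = 0 := by
    intro k hk
    by_contra hne
    obtain ⟨-, -, e10, -⟩ := conj_w_apply w00 w01 w10 w11 k
    have hlow := lower_mem_of_upper_mem hL' (movw.2 hk) (by rw [e10]; exact hne)
    obtain ⟨f00, f01, -, f11⟩ := conj_w_apply w00 w01 w10 w11 uU
    have huU' := movw.1 (hlow (w⁻¹ * uU * w) (by rw [f01, uU10]) (by rw [f00, uU11])
      (by rw [f11, uU00]))
    exact huU1 (Subgroup.disjoint_def.1 hdK huU huU')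
  -- Step 5: diagonal images and counting.
  obtain ⟨φ, hφ⟩ := exists_diagUpper hB
  obtain ⟨φ', hφ'⟩ := exists_diagLower hB'
  have hmeet : ∀ d, d ∈ φ.range → d ∈ φ'.range → d = 1 := fun d h1 h2 =>
    diag_meet_trivial_of_disjoint hB hU hB' hU' hdK hφ hφ' h1 h2
  have hDD := card_mul_card_le_of_meet_trivial hmeet
  have c1 := card_le_of_diag_upper hB φ hφ
  have c2 := card_le_of_diag_lower hB' φ' hφ'
  rw [Subgroup.card_map_of_injective (MulAut.conj c⁻¹).injective] at c1 c2
  calc Nat.card H * Nat.card H' ≤ (p * Nat.card φ.range) * (p * Nat.card φ'.range) :=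
        Nat.mul_le_mul c1 c2
    _ = p ^ 2 * (Nat.card φ.range * Nat.card φ'.range) := by ring
    _ ≤ p ^ 2 * (p - 1) ^ 2 := Nat.mul_le_mul_left _ hDD

/-! ### Corollaries for subgroup TPP triples -/

variable {H₁ H₂ H₃ : Subgroup (GLm p 2)}

/-- In a subgroup TPP triple, two members of order divisible by `p` have
`|H₁| · |H₂| ≤ p² (p - 1)²`. -/
theorem tpp_product_le₁₂ (htpp : SubgroupTPP H₁ H₂ H₃) (h₁ : p ∣ Nat.card H₁)
    (h₂ : p ∣ Nat.card H₂) : Nat.card H₁ * Nat.card H₂ ≤ p ^ 2 * (p - 1) ^ 2 :=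
  disjoint_product_le (StandardLines.subgroupTPP_disjoint htpp).1 h₁ h₂

/-- The same for the members `H₁, H₃`. -/
theorem tpp_product_le₁₃ (htpp : SubgroupTPP H₁ H₂ H₃) (h₁ : p ∣ Nat.card H₁)
    (h₃ : p ∣ Nat.card H₃) : Nat.card H₁ * Nat.card H₃ ≤ p ^ 2 * (p - 1) ^ 2 :=
  disjoint_product_le (StandardLines.subgroupTPP_disjoint htpp).2.1 h₁ h₃

/-- The same for the members `H₂, H₃`. -/
theorem tpp_product_le₂₃ (htpp : SubgroupTPP H₁ H₂ H₃) (h₂ : p ∣ Nat.card H₂)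
    (h₃ : p ∣ Nat.card H₃) : Nat.card H₂ * Nat.card H₃ ≤ p ^ 2 * (p - 1) ^ 2 :=
  disjoint_product_le (StandardLines.subgroupTPP_disjoint htpp).2.2 h₂ h₃

/-- **Volume bound with two members of order divisible by `p`.**
`|H₁| |H₂| |H₃| ≤ p² (p - 1)² · |H₃|` whenever `p ∣ |H₁|` and `p ∣ |H₂|`. -/
theorem volume_le_of_two_pMembers (htpp : SubgroupTPP H₁ H₂ H₃) (h₁ : p ∣ Nat.card H₁)
    (h₂ : p ∣ Nat.card H₂) :
    Nat.card H₁ * Nat.card H₂ * Nat.card H₃ ≤ p ^ 2 * (p - 1) ^ 2 * Nat.card H₃ :=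
  Nat.mul_le_mul_right _ (tpp_product_le₁₂ htpp h₁ h₂)

end TwoSylowLaw

end Summit.MatrixMultiplication.MatrixMultiplication.Theorems.SubgroupIdentityDesigns.Negative
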